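import Mathlib
import Literature.Analysis.FluidPDE.Tao2016AveragedNS.SelfSimilarCascadeBlowup
import Literature.Analysis.FluidPDE.Tao2016AveragedNS.BoundedEternalSolutions
import HarnessLib

/-!
# DSS waves ARE the shift-periodic admissible eternal solutions — the dictionary converse of `dssEmbed`,
  and the classification stub `stub_eternalIsDSS` of K2(1) `TaoLadderRungTwoBreak.BlowupRigidityOne`
  (stmt-NavierStokesRegularity-20206) REDUCED TO A PERIODIC-COMPANION PROPERTY

MODEL lattice ODEs only (Tao 2016 §4 (4.8) written in the self-similar log-time variables of §6.4, the
cell vocabulary `IsEternal` / `IsDSSWave` / `EternalSurvivingFwd` / `Surviving` of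
`RenormalisedCascadeWaves`); nothing in this file is a statement about the Navier–Stokes equations,
and NO item is closed by it (`--supports stmt-NavierStokesRegularity-20206`). Route-independent
(general `m`; `m = 4` in the stub-shaped corollary). DEF-FREE: the profile family read off a
shift-periodic solution is the explicit lambda `fun r x => W r (x + r T)`, the shape permutation is
Mathlib's `finRotate q`.

The tree has the embedding direction (`IsDSSWave.isEternal_dssEmbed`, `uniformBound_dssEmbed`,
`eternalSurvivingFwd_dssEmbed`: an admissible DSS wave with a surviving delay, read shell-wise, is a
uniformly bounded admissible eternal solution surviving forward, and it is SHIFT-PERIODIC: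
`W_{n+|π|}(σ) = W_n(σ - |π| T)`). This file proves the converse:

* `shiftPeriodic_iterate`, `shiftPeriodic_reduce` — bookkeeping of the period relation
  `W (n + q) σ = W n (σ - q T)`;
* `isDSSWave_of_shiftPeriodic` — **an admissible eternal solution that is shift-periodic with period
  `q ≥ 1` and delay `T > 0` IS an admissible DSS wave** of period `q`, shape permutation `finRotate q`,
  delay `T`, profile family `Φ_r(x) = W_r(x + rT)` (profile system from the lattice law by translation;
  integrable summed mass from the action clause; forward energy bound from the `bdd` clause);
* `exists_ne_zero_of_eternalSurvivingFwd`, `profile_ne_zero_of_shiftPeriodic` — a forward-surviving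
  solution is non-trivial, and non-triviality descends to the `q` profiles;
* `survivingDSSWave_of_shiftPeriodic` — packaged: shift-periodic admissible eternal + `Surviving 1 ε₀ T`
  + forward survival ⇒ the CONCLUSION of `stub_eternalIsDSS` / of the crux (a non-trivial (S₁)-surviving
  admissible DSS wave of the table);
* `stub_eternalIsDSS_of_periodicCompanions` — **the REGISTERED STUB SIGNATURE of `stub_eternalIsDSS`
  (skeleton `9d85f4d387c689cd`) VERBATIM** from the PERIODIC-COMPANION PROPERTY: below a threshold, every
  `E₂(R)` table carrying a forward-surviving admissible eternal solution carries a SHIFT-PERIODIC one with a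
  sub-unitary (S₁)-surviving delay. This is the honest content of «classification»: asymptotic
  shift-periodicity (rigidity) of surviving eternal solutions of the renormalised lattice.

HONEST LABEL: dictionary + reduction only; the periodic-companion property (= the classification) is OPEN
and research-level (non-DSS renormalised attractors are printed for shell models, arXiv:2501.07377,
arXiv:1201.1631); `stub_eternalFromBlowup` untouched; no stub, crux or summit is proved; rung 0.
-/

noncomputable section

-- the summit and its single sub-problem share the name (CONVENTIONS §1)
set_option linter.dupNamespace false

open Set Filter Topology MeasureTheory

namespace Summit.NavierStokesRegularity.NavierStokesRegularity.Theorems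

namespace BlowupRigidityOne

open Literature.Analysis.FluidPDE Literature.Analysis.FluidPDE.TaoCascade

variable {m : ℕ}

/-- Iterating the period relation: `W (n + k q) σ = W n (σ - k q T)` for every `k ∈ ℕ`.
[cite: Tao2016AveragedNS, §4 Lemma 4.1 (4.8) in self-similar variables; cell vocabulary (shift-periodicity of a lattice solution)] -/
theorem shiftPeriodic_iterate {W : ℤ → ℝ → Em m} {q : ℕ} {T : ℝ}
    (hper : ∀ (n : ℤ) (σ : ℝ), W (n + q) σ = W n (σ - q * T)) :
    ∀ (k : ℕ) (n : ℤ) (σ : ℝ), W (n + (k : ℤ) * (q : ℤ)) σ = W n (σ - (k : ℝ) * (q : ℝ) * T) := by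
  intro k
  induction k with
  | zero => intro n σ; simp
  | succ k ih =>
    intro n σ
    have e1 : n + ((k + 1 : ℕ) : ℤ) * (q : ℤ) = (n + (k : ℤ) * (q : ℤ)) + q := by push_cast; ring
    have e2 : σ - ((k + 1 : ℕ) : ℝ) * (q : ℝ) * T = σ - (q : ℝ) * T - (k : ℝ) * (q : ℝ) * T := by
      push_cast; ring
    rw [e1, hper, ih, e2]

/-- Reduction of a natural shell index to its residue: `W n σ = W (n % q) (σ - (n / q) q T)`.
[cite: Tao2016AveragedNS, §4 Lemma 4.1 (4.8) in self-similar variables; cell vocabulary] -/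
theorem shiftPeriodic_reduce {W : ℤ → ℝ → Em m} {q : ℕ} {T : ℝ}
    (hper : ∀ (n : ℤ) (σ : ℝ), W (n + q) σ = W n (σ - q * T)) (n : ℕ) (σ : ℝ) :
    W (n : ℤ) σ = W ((n % q : ℕ) : ℤ) (σ - ((n / q : ℕ) : ℝ) * (q : ℝ) * T) := by
  have e : (n : ℤ) = ((n % q : ℕ) : ℤ) + ((n / q : ℕ) : ℤ) * (q : ℤ) := by
    have h : n % q + n / q * q = n := by rw [Nat.mul_comm]; exact Nat.mod_add_div n q
    exact_mod_cast h.symm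
  rw [e, shiftPeriodic_iterate hper]

/-- **THE DICTIONARY CONVERSE OF `dssEmbed`: a shift-periodic admissible eternal solution is an admissible
DSS wave.** If `W` is an admissible eternal solution of the renormalised lattice of `α` at ratio `1+ε₀`
(`IsEternal`) with `W_{n+q}(σ) = W_n(σ - qT)` for all `n, σ` (`q = p+1 ≥ 1`, `T > 0`), then the profile
family `Φ_r(x) = W_r(x + rT)`, `r ∈ Fin q`, with the cyclic shape permutation `finRotate q` and delay `T`,
is an admissible DSS wave of `α` (`IsDSSWave ε₀ α (finRotate q) T Φ`): the profile system is the lattice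
law translated by `rT` (the wrap-around terms `r = 0` / `r = q-1` are exactly the period relation), the
summed mass is integrable by the action clause, and the renormalised energy is bounded forward by the
`bdd` clause of the `q` base shells.
[cite: Tao2016AveragedNS, §4 Lemma 4.1 (iii) (4.8) written in self-similar variables (the DSS ansatz `X_n = Λ^{-n} e^{s} Φ_{r(n)}(s - nT)`), §6.4; cell vocabulary (`IsEternal`, `IsDSSWave`)] -/
theorem isDSSWave_of_shiftPeriodic {ε₀ T : ℝ} {α : Fin m → Fin m → Fin m → ℤ × ℤ × ℤ → ℝ}
    {W : ℤ → ℝ → Em m} (hW : IsEternal ε₀ α W) {p : ℕ} (hT : 0 < T)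
    (hper : ∀ (n : ℤ) (σ : ℝ), W (n + ((p + 1 : ℕ) : ℤ)) σ = W n (σ - ((p + 1 : ℕ) : ℝ) * T)) :
    IsDSSWave ε₀ α (finRotate (p + 1)) T
      (fun (r : Fin (p + 1)) (x : ℝ) => W (r.val : ℤ) (x + (r.val : ℝ) * T)) := by
  refine ⟨hT, ?_, ?_, ?_⟩
  · -- the profile system = the lattice law of shell `r` translated by `rT`
    intro r x
    -- the shell ahead: profile `finRotate r` at phase `x - T` is shell `r+1` at log-time `x + rT`
    have efwd : W (((finRotate (p + 1)) r).val : ℤ) (x - T + (((finRotate (p + 1)) r).val : ℝ) * T)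
        = W ((r.val : ℤ) + 1) (x + (r.val : ℝ) * T) := by
      by_cases hr : r = Fin.last p
      · subst hr
        rw [finRotate_last]
        have h := hper 0 (x + (p : ℝ) * T)
        have e1 : x + (p : ℝ) * T - ((p + 1 : ℕ) : ℝ) * T = x - T + ((0 : Fin (p + 1)).val : ℝ) * T := by
          simp only [Fin.val_zero, Nat.cast_add, Nat.cast_one, CharP.cast_eq_zero]; ring
        have e2 : (0 : ℤ) + ((p + 1 : ℕ) : ℤ) = ((Fin.last p).val : ℤ) + 1 := by
          simp only [Fin.val_last]; push_cast; ring
        rw [e1, e2] at h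
        simpa only [Fin.val_last, Fin.val_zero, CharP.cast_eq_zero] using h.symm
      · rw [coe_finRotate_of_ne_last hr]
        push_cast
        ring_nf
    -- the shell behind: profile `finRotate⁻¹ r` at phase `x + T` is shell `r-1` at log-time `x + rT`
    have ebwd : W (((finRotate (p + 1)).symm r).val : ℤ) (x + T + (((finRotate (p + 1)).symm r).val : ℝ) * T)
        = W ((r.val : ℤ) - 1) (x + (r.val : ℝ) * T) := by
      by_cases hr : r = 0
      · subst hr
        have hs : (finRotate (p + 1)).symm 0 = Fin.last p := by
          rw [Equiv.symm_apply_eq]; exact (finRotate_last).symm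
        rw [hs]
        have h := hper (-1) (x + ((p + 1 : ℕ) : ℝ) * T)
        have e1 : (-1 : ℤ) + ((p + 1 : ℕ) : ℤ) = ((Fin.last p).val : ℤ) := by
          simp only [Fin.val_last]; push_cast; ring
        have e2 : x + ((p + 1 : ℕ) : ℝ) * T - ((p + 1 : ℕ) : ℝ) * T = x + ((0 : Fin (p + 1)).val : ℝ) * T := by
          simp only [Fin.val_zero, CharP.cast_eq_zero]; ring
        have e3 : x + ((p + 1 : ℕ) : ℝ) * T = x + T + ((Fin.last p).val : ℝ) * T := by
          simp only [Fin.val_last]; push_cast; ring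
        rw [e1, e2, e3] at h
        simpa only [Fin.val_zero, CharP.cast_eq_zero, zero_sub] using h
      · rw [coe_finRotate_symm_of_ne_zero hr]
        obtain ⟨k, hk⟩ := Nat.exists_eq_succ_of_ne_zero (Fin.val_ne_zero_iff.2 hr)
        rw [hk, Nat.succ_sub_one]
        push_cast
        ring_nf
    have hlaw := (hW.law (r.val : ℤ) (x + (r.val : ℝ) * T)).comp_add_const x ((r.val : ℝ) * T)
    simp only []
    rw [efwd, ebwd]
    exact hlaw
  · -- integrable summed mass: a finite sum of translates of the integrable shell norms
    obtain ⟨M, hM⟩ := hW.action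
    show Integrable (fun x => ∑ r : Fin (p + 1), ‖W (r.val : ℤ) (x + (r.val : ℝ) * T)‖)
    refine integrable_finsetSum _ fun r _ => ?_
    exact (hM (r.val : ℤ)).1.comp_add_right ((r.val : ℝ) * T)
  · -- forward bound of the renormalised summed energy from the `bdd` clause of the base shells
    choose σ₀ P hP using hW.bdd
    refine ⟨∑ r : Fin (p + 1), |σ₀ (r.val : ℤ) - (r.val : ℝ) * T|,
      ∑ r : Fin (p + 1), Real.exp (-(2 * ((r.val : ℝ) * T))) * |P (r.val : ℤ)|, fun x hx => ?_⟩
    show Real.exp (2 * 1 * x) * ∑ r : Fin (p + 1), ‖W (r.val : ℤ) (x + (r.val : ℝ) * T)‖ ^ 2 ≤ _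
    rw [Finset.mul_sum]
    refine Finset.sum_le_sum fun r _ => ?_
    have hx' : σ₀ (r.val : ℤ) ≤ x + (r.val : ℝ) * T := by
      have h1 : |σ₀ (r.val : ℤ) - (r.val : ℝ) * T| ≤ ∑ r' : Fin (p + 1), |σ₀ (r'.val : ℤ) - (r'.val : ℝ) * T| :=
        Finset.single_le_sum (f := fun r' : Fin (p + 1) => |σ₀ (r'.val : ℤ) - (r'.val : ℝ) * T|)
          (fun _ _ => abs_nonneg _) (Finset.mem_univ r)
      have h2 := le_abs_self (σ₀ (r.val : ℤ) - (r.val : ℝ) * T)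
      linarith
    have hb := hP (r.val : ℤ) (x + (r.val : ℝ) * T) hx'
    have hexp : Real.exp (2 * 1 * x) = Real.exp (-(2 * ((r.val : ℝ) * T))) * Real.exp (2 * (x + (r.val : ℝ) * T)) := by
      rw [← Real.exp_add]; ring_nf
    rw [hexp, mul_assoc]
    exact mul_le_mul_of_nonneg_left (hb.trans (le_abs_self _)) (Real.exp_pos _).le

/-- A forward-surviving solution is non-trivial: some shell is non-zero at some log-time.
[cite: Tao2016AveragedNS, §4, §6.4; cell vocabulary (`EternalSurvivingFwd`)] -/
theorem exists_ne_zero_of_eternalSurvivingFwd {a ε₀ : ℝ} {W : ℤ → ℝ → Em m}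
    (hS : EternalSurvivingFwd a ε₀ W) : ∃ (n : ℕ) (σ : ℝ), W (n : ℤ) σ ≠ 0 := by
  obtain ⟨c, hc, H⟩ := hS
  obtain ⟨n, -, σ, -, hle⟩ := H 0
  refine ⟨n, σ, fun h0 => ?_⟩
  rw [h0, norm_zero] at hle
  have : c ≤ 0 := by simpa using hle
  linarith

/-- Non-triviality descends to the profiles of a shift-periodic solution: if some shell is non-zero
somewhere, some profile `Φ_r(x) = W_r(x + rT)`, `r ∈ Fin q`, is non-zero somewhere.
[cite: Tao2016AveragedNS, §4 Lemma 4.1 (4.8) in self-similar variables; cell vocabulary] -/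
theorem profile_ne_zero_of_shiftPeriodic {W : ℤ → ℝ → Em m} {p : ℕ} {T : ℝ}
    (hper : ∀ (n : ℤ) (σ : ℝ), W (n + ((p + 1 : ℕ) : ℤ)) σ = W n (σ - ((p + 1 : ℕ) : ℝ) * T))
    {n : ℕ} {σ : ℝ} (hne : W (n : ℤ) σ ≠ 0) :
    ∃ (r : Fin (p + 1)) (x : ℝ),
      (fun (r : Fin (p + 1)) (x : ℝ) => W (r.val : ℤ) (x + (r.val : ℝ) * T)) r x ≠ 0 := by
  refine ⟨⟨n % (p + 1), Nat.mod_lt _ (Nat.succ_pos p)⟩,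
    σ - ((n / (p + 1) : ℕ) : ℝ) * ((p + 1 : ℕ) : ℝ) * T - ((n % (p + 1) : ℕ) : ℝ) * T, ?_⟩
  simp only []
  rw [shiftPeriodic_reduce hper n σ] at hne
  have e : σ - ((n / (p + 1) : ℕ) : ℝ) * ((p + 1 : ℕ) : ℝ) * T - ((n % (p + 1) : ℕ) : ℝ) * T
      + ((n % (p + 1) : ℕ) : ℝ) * T = σ - ((n / (p + 1) : ℕ) : ℝ) * ((p + 1 : ℕ) : ℝ) * T := by ring
  rw [e]
  exact hne

/-- **PACKAGED: a shift-periodic admissible eternal solution with a sub-unitary (S₁)-surviving delay that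
survives forward IS (read profile-wise) a non-trivial (S₁)-surviving admissible DSS wave** — the conclusion
of the crux K2(1) / of `stub_eternalIsDSS`, for a general table `α` (any `m`).
[cite: Tao2016AveragedNS, §4 Lemma 4.1 (iii) (4.8), §6.4; cell vocabulary (`IsEternal`, `IsDSSWave`, `Surviving`, `EternalSurvivingFwd`)] -/
theorem survivingDSSWave_of_shiftPeriodic {ε₀ T a : ℝ} {α : Fin m → Fin m → Fin m → ℤ × ℤ × ℤ → ℝ}
    {W : ℤ → ℝ → Em m} (hW : IsEternal ε₀ α W) {q : ℕ} (hq : 0 < q) (hT : 0 < T)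
    (hper : ∀ (n : ℤ) (σ : ℝ), W (n + q) σ = W n (σ - q * T))
    (hμ : Surviving 1 ε₀ T) (hS : EternalSurvivingFwd a ε₀ W) :
    ∃ (q : ℕ) (π : Equiv.Perm (Fin q)) (T : ℝ) (Φ : Fin q → ℝ → Em m),
      IsDSSWave ε₀ α π T Φ ∧ Surviving 1 ε₀ T ∧ ∃ r x, Φ r x ≠ 0 := by
  obtain ⟨p, rfl⟩ := Nat.exists_eq_succ_of_ne_zero hq.ne'
  obtain ⟨n, σ, hne⟩ := exists_ne_zero_of_eternalSurvivingFwd hS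
  exact ⟨p + 1, finRotate (p + 1), T, fun r x => W (r.val : ℤ) (x + (r.val : ℝ) * T),
    isDSSWave_of_shiftPeriodic hW hT hper, hμ, profile_ne_zero_of_shiftPeriodic hper hne⟩

/-- **THE REGISTERED STUB `stub_eternalIsDSS` (skeleton `9d85f4d387c689cd` of item 20206) MODULO THE
PERIODIC-COMPANION PROPERTY.** If below a threshold `ε_s(R)` every table `α ∈ E₂(R)` that carries a
forward-(S₁)-surviving admissible eternal solution also carries a SHIFT-PERIODIC admissible eternal solution
(`W_{n+q}(σ) = W_n(σ - qT)`, `q ≥ 1`, `T > 0`) with an (S₁)-surviving sub-unitary delay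
(`Surviving 1 ε₀ T`) that survives forward, then the signature of `stub_eternalIsDSS` holds verbatim:
such a table carries a non-trivial (S₁)-surviving admissible DSS wave. (The converse embedding is the
tree's `IsDSSWave.isEternal_dssEmbed` / `eternalSurvivingFwd_dssEmbed`.)
[cite: Tao2016AveragedNS, §4 Thm. 4.2 (statement shape), Lemma 4.1 (4.8), §6.4; cell vocabulary (`InTableClass`, `IsEternal`, `EternalSurvivingFwd`, `IsDSSWave`, `Surviving`)] -/
theorem stub_eternalIsDSS_of_periodicCompanions
    (H : ∀ R : ℝ, 1 ≤ R → ∃ εs : ℝ, 0 < εs ∧ ∀ ε₀ : ℝ, 0 < ε₀ → ε₀ ≤ εs →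
      ∀ α : (Fin 4 → Fin 4 → Fin 4 → ℤ × ℤ × ℤ → ℝ), InTableClass R α →
        (∃ W : ℤ → ℝ → Em 4, IsEternal ε₀ α W ∧ EternalSurvivingFwd 1 ε₀ W) →
        ∃ (W : ℤ → ℝ → Em 4) (q : ℕ) (T : ℝ), 0 < q ∧ 0 < T ∧ Surviving 1 ε₀ T ∧
          IsEternal ε₀ α W ∧ (∀ (n : ℤ) (σ : ℝ), W (n + q) σ = W n (σ - q * T)) ∧
          EternalSurvivingFwd 1 ε₀ W) :
    ∀ R : ℝ, 1 ≤ R → ∃ εs : ℝ, 0 < εs ∧ ∀ ε₀ : ℝ, 0 < ε₀ → ε₀ ≤ εs →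
      ∀ α : (Fin 4 → Fin 4 → Fin 4 → ℤ × ℤ × ℤ → ℝ),
        Literature.Analysis.FluidPDE.TaoCascade.InTableClass R α →
        (∃ W : ℤ → ℝ → Literature.Analysis.FluidPDE.TaoCascade.Em 4,
          Literature.Analysis.FluidPDE.TaoCascade.IsEternal ε₀ α W ∧
          Literature.Analysis.FluidPDE.TaoCascade.EternalSurvivingFwd 1 ε₀ W) →
        ∃ (q : ℕ) (π : Equiv.Perm (Fin q)) (T : ℝ)
          (Φ : Fin q → ℝ → Literature.Analysis.FluidPDE.TaoCascade.Em 4),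
          Literature.Analysis.FluidPDE.TaoCascade.IsDSSWave ε₀ α π T Φ ∧
          Literature.Analysis.FluidPDE.TaoCascade.Surviving 1 ε₀ T ∧ ∃ r x, Φ r x ≠ 0 := by
  intro R hR
  obtain ⟨εs, hεs, hH⟩ := H R hR
  refine ⟨εs, hεs, fun ε₀ hε hεle α hα hex => ?_⟩
  obtain ⟨W, q, T, hq, hT, hμ, hW, hper, hS⟩ := hH ε₀ hε hεle α hα hex
  exact survivingDSSWave_of_shiftPeriodic hW hq hT hper hμ hS

end BlowupRigidityOne

end Summit.NavierStokesRegularity.NavierStokesRegularity.Theorems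

end
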